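import Summits.HodgeConjecture.HodgeConjecture.Theorems.F0P3ClassificationLaws
import HarnessLib

/-!
# `F0P3ClassificationEngine` (T5-C): the integrator's own mathematics — Z3 `separation_of_laws`, Z2 `perClassIdentity_of_laws` (separating by Hecke
# eigenvalues, (14.6.1) ⇒ (14.6.2)), Z10a `coefficientFormula_of_laws` (coefficient reading), and the law theorems proved from the pins — kit-parametric

Theorems rendering (F0P3-plan (g4) RULINGS (V9)(b)∕(V12), F0P3-p03 (g6)) of the T5 statement layer = dossier line
`Cruxes/H413/Lines/F0_T5InnerFormClassification.lean` (v3.1 c06f45df; PLAN.F0P3g4 §22–§25), split by topic into four ★-importable modules sharing the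
namespace `…Cruxes.H413.F0P3InnerFormClassification` (Theorems never import Lines): (A) `F0P3ClassificationKit` — frame, e.v.p. germs, the kit, pins;
(B) `F0P3ClassificationLaws` — the named laws and the intermediate statements (14.6.2) ∕ coefficient formula; (C) `F0P3ClassificationEngine` — the
integrator's own mathematics Z3∕Z2∕Z10a, PROVED; (D) `F0P3InnerFormClassification` — glue, the head `shape_of_T5`, the kit-family composition
`shapeGuarded_of_T5`.  Declarations and proofs are BYTE-IDENTICAL to the dossier text; only module docstrings, the namespace name, a few one-line
docstrings (Theorems lint) and the re-emitted `variable` blocks differ.  No `sorry`, no named fact, no instance, no notation.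

THIS MODULE: §2 of the dossier line, theorems only (over ★ B1 `F0P3SeparationRegroup`, ★ `F0P3SeparationLemmaOfBounded`, ★ D9).
HONEST LABEL: HC_CM is proved only modulo the printed citations until rung 0 closes.
-/

attribute [local instance 100] LieRing.ofAssociativeRing

set_option autoImplicit false
set_option linter.dupNamespace false

noncomputable section

open NumberField IsDedekindDomain MeasureTheory
open scoped Matrix ComplexOrder BigOperators Classical

namespace Summit.HodgeConjecture.HodgeConjecture.Cruxes.H413.F0P3InnerFormClassification

open Literature.NumberTheory.Rogawski1990 Literature.NumberTheory.GaloisRepresentations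
open Literature.NumberTheory.Automorphic Literature.NumberTheory.Automorphic.UnitaryGroup
open Literature.NumberTheory.Automorphic.UnitaryGroup.CotangentForms
open Literature.RepresentationTheory.BorelWallach2000
open Literature.RepresentationTheory.KonnoKonno2007

/-! ## §2 THE INTEGRATOR'S OWN MATHEMATICS — Z3, Z2, Z10a, all PROVED (kit-parametric; PLAN §24–§25; no `sorry` remains in this file) -/

/-- **Z3 — THE SEPARATION LEMMA from injectivity + unitary bound + `*`-algebra, DISCHARGED IN-HOUSE** [Langlands1980 pp. 208–211 (Stone–Weierstrass on the
compact closure of the bounded parameters; `f = 1` for `Σ|α| < ∞`); Rogawski1990 §13.7 p. 206] := ★ p816508 `separationLemma_of_injective_bounded_starClosed`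
(F0P4-p02 (g5), over ★ p816337 `Literature.Topology.SummableDiracCombSeparation`).  (L1) is OFF the letter ledger. -/
theorem separation_of_laws {L : Type} [Field L] [NumberField L] [IsCMField L] {H : Matrix (Fin 3) (Fin 3) L} {ι : L →+* ℂ} {T : GL (Fin 3) ℂ}
    {hT : (T : Matrix (Fin 3) (Fin 3) ℂ)ᴴ * H.map ι * (T : Matrix (Fin 3) (Fin 3) ℂ) = Literature.Geometry.ComplexHyperbolic.BallModel.J}
    {μ : Measure (Gp L H).automorphicQuotient} [(Gp L H).IsAutomorphicMeasure μ] (𝔠 : ClassificationKit L H ι T hT μ)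
    (hi : 𝔠.HatInjective) (hb : 𝔠.HatBounded) (ha : 𝔠.UnrStarAlgebra) :
    𝔠.Separation :=
  fun S => F0P3SeparationRegroup.separationLemma_of_injective_bounded_starClosed (𝔠.hatAut S) (hi S) (hb S) (ha S).1 (ha S).2.1 (ha S).2.2

/-- **(L1-ii) FOR THE CLASS SUMMAND, FROM THE PINS — Langlands' unitary bound** [Langlands1980 p. 209; Rogawski1990 §13.7 p. 206]: for every `f^S ∈ Unr S` there is
`C = C(f^S)` with `|f^{S∧}(t(π′))| ≤ C` for EVERY class `π′` unramified off `S`.  Proof: by pin (vii) `f^{S∧}(t) = ∏_{v ∈ T} t_v(f_v)` (`T` finite, off `S`); for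
`v ∈ T` the class `clFin c v` is `K_v`-spherical with eigencharacter `t_v = evp c v` (pin (ii), `v ∉ S ⊇ ramCls c`), admissible (iv) and unitarizable (v), `μv v` is
Haar (iii) so `μ(K_v) ≠ 0`, and ★ p817229 `IsSphericalWith.norm_apply_le_inv_mul_integral_norm` bounds `|t_v(f_v)| ≤ μ(K_v)⁻¹ ∫ |f_v|` independently of the class;
take `C := ∏_{v ∈ T} μ(K_v)⁻¹ ∫ |f_v|`.  (The packet summands `evpG`, `evpH` of `AutGerm` have no local-class anchor in this kit: for them `HatBounded` stays a law.)
[cite: Langlands1980, p. 209] [cite: Rogawski1990, §13.7 p. 206] -/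
theorem hatBounded_cls_of_pins {L : Type} [Field L] [NumberField L] [IsCMField L] {H : Matrix (Fin 3) (Fin 3) L} {ι : L →+* ℂ} {T : GL (Fin 3) ℂ}
    {hT : (T : Matrix (Fin 3) (Fin 3) ℂ)ᴴ * H.map ι * (T : Matrix (Fin 3) (Fin 3) ℂ) = Literature.Geometry.ComplexHyperbolic.BallModel.J}
    {μ : Measure (Gp L H).automorphicQuotient} [(Gp L H).IsAutomorphicMeasure μ] (𝔠 : ClassificationKit L H ι T hT μ)
    (hpin : 𝔠.IsPinned) (S : Finset (Places L)) (fT : 𝔠.Unr S) :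
    ∃ C : ℝ, ∀ c : 𝔠.Cls, 𝔠.ramCls c ⊆ S → ‖𝔠.hat S (germ L H S (𝔠.evp c)) fT‖ ≤ C := by
  classical
  obtain ⟨-, hsph, hhaar, hadm, hunit, -, hhat, -⟩ := hpin
  obtain ⟨T, hTS, f, hf, hfac⟩ := hhat S fT
  -- the per-place constants `μ(K_v)⁻¹ ∫ ‖f_v‖`
  refine ⟨∏ v ∈ T, (letI : MeasurableSpace ((cmDatum L 3 H).Local v) := borel _
    ((𝔠.μv v).real (cmLocalIntegralLevel L 3 H v : Set ((cmDatum L 3 H).Local v)))⁻¹ * ∫ x, ‖f v x‖ ∂(𝔠.μv v)), fun c hc => ?_⟩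
  rw [hfac (𝔠.evp c)]
  refine (Finset.norm_prod_le _ _).trans (Finset.prod_le_prod (fun v _ => norm_nonneg _) fun v hv => ?_)
  -- at `v ∈ T`: `v ∉ S`, hence `v ∉ ramCls c`, so `clFin c v` is spherical with eigencharacter `evp c v`
  have hvS : v ∉ S := fun h => Finset.disjoint_left.1 hTS hv h
  have hvr : v ∉ 𝔠.ramCls c := fun h => hvS (hc h)
  letI : MeasurableSpace ((cmDatum L 3 H).Local v) := borel _
  haveI : BorelSpace ((cmDatum L 3 H).Local v) := ⟨rfl⟩
  haveI : (𝔠.μv v).IsHaarMeasure := hhaar v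
  obtain ⟨hKc, hKo⟩ := UnitaryGroup.isCompact_isOpen_cmLocalIntegralLevel L 3 H v
  have hμK : (𝔠.μv v).real (cmLocalIntegralLevel L 3 H v : Set ((cmDatum L 3 H).Local v)) ≠ 0 := by
    rw [measureReal_def, ENNReal.toReal_ne_zero]
    exact ⟨(hKo.measure_pos (𝔠.μv v) ⟨1, (cmLocalIntegralLevel L 3 H v).one_mem⟩).ne', hKc.measure_lt_top.ne⟩
  exact (hsph c v hvr).norm_apply_le_inv_mul_integral_norm (𝔠.μv v) (hadm c v hvr) (hunit c v hvr) hKo hKc hμK (hf v hv).1 (hf v hv).2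

/-- **(L7′) `ClassDet` FROM THE PINS + FLATH, DISCHARGED IN-HOUSE (F0P3-p01 (g7) paste-closer)** [Flath1979 Thm. 3; CartierCorvallis1979 §IV.1 Thm. 4.1, Cor. 4.1;
Rogawski1990 §13.7 p. 206 («separating by Hecke eigenvalues»)]: two classes unramified off `S` with the same e.v.p. germ off `S` have, at every `v ∉ S`, two ADMISSIBLE
(pin (iv)) coordinates that are `K_v`-spherical with ONE eigencharacter (pin (ii) along `EqOff`) for a Haar measure (pin (iii), `μ_v(K_v) ≠ 0` since `K_v` is compact
open, ★ `isCompact_isOpen_cmLocalIntegralLevel`) — hence EQUAL by ★ p816113 `IrrClass.eq_of_isSphericalWith`; with equal `S ∪ ∞`-coordinates the two classes agree at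
every place and coincide by (L7) `FlathDet`.  (L7′) is OFF the letter ledger. -/
theorem classDet_of_pins {L : Type} [Field L] [NumberField L] [IsCMField L] {H : Matrix (Fin 3) (Fin 3) L} {ι : L →+* ℂ} {T : GL (Fin 3) ℂ}
    {hT : (T : Matrix (Fin 3) (Fin 3) ℂ)ᴴ * H.map ι * (T : Matrix (Fin 3) (Fin 3) ℂ) = Literature.Geometry.ComplexHyperbolic.BallModel.J}
    {μ : Measure (Gp L H).automorphicQuotient} [(Gp L H).IsAutomorphicMeasure μ] (𝔠 : ClassificationKit L H ι T hT μ)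
    (hpin : 𝔠.IsPinned) (hF : 𝔠.FlathDet) :
    𝔠.ClassDet := by
  intro S c c' hc hc' he hco
  simp only [ClassificationKit.coordS, Prod.mk.injEq] at hco
  obtain ⟨hinf, h0, hfin⟩ := hco
  refine hF c c' hinf h0 fun v => ?_
  by_cases hv : v ∈ S
  · exact congrFun hfin ⟨v, hv⟩
  · letI : MeasurableSpace ((cmDatum L 3 H).Local v) := borel _
    haveI : BorelSpace ((cmDatum L 3 H).Local v) := ⟨rfl⟩
    haveI : (𝔠.μv v).IsHaarMeasure := hpin.2.2.1 v
    have hK := isCompact_isOpen_cmLocalIntegralLevel L 3 H v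
    have hμK : (𝔠.μv v).real (cmLocalIntegralLevel L 3 H v : Set ((cmDatum L 3 H).Local v)) ≠ 0 := by
      rw [measureReal_def, ENNReal.toReal_ne_zero]
      exact ⟨(hK.2.measure_pos (𝔠.μv v) ⟨1, (cmLocalIntegralLevel L 3 H v).one_mem⟩).ne', hK.1.measure_lt_top.ne⟩
    have h₁ := hpin.2.1 c v fun h => hv (hc h)
    have h₂ := hpin.2.1 c' v fun h => hv (hc' h)
    rw [he v hv] at h₁
    exact IrrClass.eq_of_isSphericalWith (𝔠.μv v) (hpin.2.2.2.1 c v fun h => hv (hc h)) (hpin.2.2.2.1 c' v fun h => hv (hc' h)) hK.2 hK.1 hμK h₁ h₂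

/-- **(L1-i) `HatInjective` FROM THE PINS — «`t ↦ f ↦ f^{S∧}(t)` is injective on germs of automorphic origin»** [Rogawski1990 §13.7 p. 206; CartierCorvallis1979
§IV.1]: with ONE junk convention for every e.v.p. field (pin (vi) for `evp`, law `EvpConvention` for `evpG`∕`evpH`) and the richness pin (viii) (single-place families),
two automorphic germs with the same `hat` agree at every `v ∉ S` on `C_c(K_v\G′_v/K_v)` (evaluate `hat` on the family carrying `f` at `v` alone), hence as functionals,
hence as germs.  No Satake isomorphism and no rigidity is used: (L1-i) is OFF the letter ledger given the pins. [cite: Rogawski1990, §13.7 p. 206] [cite: CartierCorvallis1979, §IV.1] -/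
theorem hatInjective_of_pins {L : Type} [Field L] [NumberField L] [IsCMField L] {H : Matrix (Fin 3) (Fin 3) L} {ι : L →+* ℂ} {T : GL (Fin 3) ℂ}
    {hT : (T : Matrix (Fin 3) (Fin 3) ℂ)ᴴ * H.map ι * (T : Matrix (Fin 3) (Fin 3) ℂ) = Literature.Geometry.ComplexHyperbolic.BallModel.J}
    {μ : Measure (Gp L H).automorphicQuotient} [(Gp L H).IsAutomorphicMeasure μ] (𝔠 : ClassificationKit L H ι T hT μ)
    (hpin : 𝔠.IsPinned) (hconv : 𝔠.EvpConvention) : 𝔠.HatInjective := by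
  classical
  obtain ⟨-, -, -, -, -, hjunk, -, hrich⟩ := hpin
  intro S g₁ g₂ h
  obtain ⟨t₁, ht₁, ho₁⟩ := g₁.2
  obtain ⟨t₂, ht₂, ho₂⟩ := g₂.2
  -- junk off the spherical Hecke algebra, for every automorphic origin
  have junk : ∀ t : EvpData L H,
      ((∃ c, 𝔠.ramCls c ⊆ S ∧ 𝔠.evp c = t) ∨ (∃ Q, 𝔠.ramG Q ⊆ S ∧ 𝔠.evpG Q = t) ∨ (∃ ρ, 𝔠.ramH ρ ⊆ S ∧ 𝔠.evpH ρ = t)) →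
      ∀ (v : Places L) (f : (cmDatum L 3 H).Local v → ℂ), ¬ (HasCompactSupport f ∧ IsLevel (cmLocalIntegralLevel L 3 H v) f) → t v f = 0 := by
    rintro t (⟨c, -, rfl⟩ | ⟨Q, -, rfl⟩ | ⟨ρ, -, rfl⟩) v f hf
    · exact hjunk c v f hf
    · exact hconv.1 Q v f hf
    · exact hconv.2.1 ρ v f hf
  apply Subtype.ext
  rw [← ht₁, ← ht₂, germ_eq_germ_iff]
  intro v hv
  funext f
  by_cases hf : HasCompactSupport f ∧ IsLevel (cmLocalIntegralLevel L 3 H v) f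
  · -- the single-place family carrying `f` at `v`
    have hTS : Disjoint ({v} : Finset (Places L)) S := Finset.disjoint_singleton_left.2 hv
    obtain ⟨fT, hfT⟩ := hrich S {v} hTS (Function.update (fun w => (0 : (cmDatum L 3 H).Local w → ℂ)) v f)
      (fun w hw => by
        rw [Finset.mem_singleton] at hw
        subst hw
        rw [Function.update_self]
        exact hf)
    have e : 𝔠.hat S g₁.1 fT = 𝔠.hat S g₂.1 fT := congrFun h fT
    rw [← ht₁, ← ht₂, hfT t₁, hfT t₂, Finset.prod_singleton, Finset.prod_singleton, Function.update_self] at e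
    exact e
  · rw [junk t₁ ho₁ v f hf, junk t₂ ho₂ v f hf]

/-- **Z2 — SEPARATING BY HECKE EIGENVALUES, PROVED (F0P3-p03 (g6) paste-closer f0193005b3c8331e, folded)** [Rogawski1990 p. 236 l. 3; §13.7 p. 206]: from (14.6.1) (`TraceIdentity`), the spectral side of `G′`,
the unramified factorisations, matching of factorised triples and the separation lemma, the identity holds GERM BY GERM: (14.6.2).  Size M (absolute
convergence bookkeeping; ★ p816018 `F0P3SeparationRegroup.regroup_by_evp` is its abstract core). -/
theorem perClassIdentity_of_laws {L : Type} [Field L] [NumberField L] [IsCMField L] {H : Matrix (Fin 3) (Fin 3) L} {ι : L →+* ℂ} {T : GL (Fin 3) ℂ}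
    {hT : (T : Matrix (Fin 3) (Fin 3) ℂ)ᴴ * H.map ι * (T : Matrix (Fin 3) (Fin 3) ℂ) = Literature.Geometry.ComplexHyperbolic.BallModel.J}
    {μ : Measure (Gp L H).automorphicQuotient} [(Gp L H).IsAutomorphicMeasure μ] (𝔠 : ClassificationKit L H ι T hT μ)
    (h1 : 𝔠.TraceIdentity) (h2 : 𝔠.SpectralSideGp) (h3 : 𝔠.Factorisation) (h4 : 𝔠.MatchingS) (h5 : 𝔠.Separation)
    (ha : 𝔠.UnrStarAlgebra) :
    𝔠.PerClassIdentity := by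
  intro S g fS fSG fSH hM
  classical
  -- the unit of the unramified Hecke algebra (L1-iii) and the matched, smooth triples `(tens fS fT, tensG fSG fT, tensH fSH fT)`
  obtain ⟨u, hu⟩ := (ha S).2.2
  -- index maps into the germs OF AUTOMORPHIC ORIGIN
  let ec : {c : 𝔠.Cls // 𝔠.ramCls c ⊆ S} → 𝔠.AutGerm S :=
    fun c => ⟨germ L H S (𝔠.evp c.1), 𝔠.evp c.1, rfl, Or.inl ⟨c.1, c.2, rfl⟩⟩
  let eQ : {Q : 𝔠.PacketG // 𝔠.ramG Q ⊆ S} → 𝔠.AutGerm S :=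
    fun Q => ⟨germ L H S (𝔠.evpG Q.1), 𝔠.evpG Q.1, rfl, Or.inr (Or.inl ⟨Q.1, Q.2, rfl⟩)⟩
  let eρ : {ρ : 𝔠.PacketH // 𝔠.ramH ρ ⊆ S} → 𝔠.AutGerm S :=
    fun ρ => ⟨germ L H S (𝔠.evpH ρ.1), 𝔠.evpH ρ.1, rfl, Or.inr (Or.inr ⟨ρ.1, ρ.2, rfl⟩)⟩
  -- (1) the three families, factorised, as `HasSum`s over the unramified indices
  have Hc : ∀ fT : 𝔠.Unr S, HasSum (fun c : {c : 𝔠.Cls // 𝔠.ramCls c ⊆ S} =>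
      (𝔠.mult c.1 : ℂ) * 𝔠.chS S (𝔠.coordS S c.1) fS * 𝔠.hatAut S (ec c) fT) (𝔠.traceGp (𝔠.tens S fS fT)) := by
    intro fT
    obtain ⟨hs, hid⟩ := h2 S fS fT
    have hoff : ∀ c : 𝔠.Cls, c ∉ Set.range (Subtype.val : {c : 𝔠.Cls // 𝔠.ramCls c ⊆ S} → 𝔠.Cls) →
        (𝔠.mult c : ℂ) * 𝔠.trGp c (𝔠.tens S fS fT) = 0 := by
      intro c hc
      have hc' : ¬ 𝔠.ramCls c ⊆ S := fun h => hc ⟨⟨c, h⟩, rfl⟩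
      rw [((h3.1 S c fS fT).2 hc'), mul_zero]
    have h := (Subtype.val_injective.hasSum_iff hoff).2 (hid ▸ hs.hasSum)
    refine h.congr_fun fun c => ?_
    simp only [Function.comp_apply]
    rw [(h3.1 S c.1 fS fT).1 c.2, mul_assoc]
    rfl
  have HQ : ∀ fT : 𝔠.Unr S, HasSum (fun Q : {Q : 𝔠.PacketG // 𝔠.ramG Q ⊆ S} =>
      𝔠.nG Q.1 * 𝔠.trGS S Q.1 fSG * 𝔠.hatAut S (eQ Q) fT) (∑' Q : 𝔠.PacketG, 𝔠.nG Q * 𝔠.trG Q (𝔠.tensG S fSG fT)) := by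
    intro fT
    obtain ⟨hsm, hmt⟩ := h4 S fS fSG fSH fT hM
    obtain ⟨hs, -, -⟩ := h1 _ _ _ hsm hmt
    have hoff : ∀ Q : 𝔠.PacketG, Q ∉ Set.range (Subtype.val : {Q : 𝔠.PacketG // 𝔠.ramG Q ⊆ S} → 𝔠.PacketG) →
        𝔠.nG Q * 𝔠.trG Q (𝔠.tensG S fSG fT) = 0 := by
      intro Q hQ
      have hQ' : ¬ 𝔠.ramG Q ⊆ S := fun h => hQ ⟨⟨Q, h⟩, rfl⟩
      rw [((h3.2.1 S Q fSG fT).2 hQ'), mul_zero]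
    have h := (Subtype.val_injective.hasSum_iff hoff).2 hs.hasSum
    refine h.congr_fun fun Q => ?_
    simp only [Function.comp_apply]
    rw [(h3.2.1 S Q.1 fSG fT).1 Q.2, mul_assoc]
    rfl
  have Hρ : ∀ fT : 𝔠.Unr S, HasSum (fun ρ : {ρ : 𝔠.PacketH // 𝔠.ramH ρ ⊆ S} =>
      𝔠.nH ρ.1 * 𝔠.trHS S ρ.1 fSH * 𝔠.hatAut S (eρ ρ) fT) (∑' ρ : 𝔠.PacketH, 𝔠.nH ρ * 𝔠.trH ρ (𝔠.tensH S fSH fT)) := by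
    intro fT
    obtain ⟨hsm, hmt⟩ := h4 S fS fSG fSH fT hM
    obtain ⟨-, hs, -⟩ := h1 _ _ _ hsm hmt
    have hoff : ∀ ρ : 𝔠.PacketH, ρ ∉ Set.range (Subtype.val : {ρ : 𝔠.PacketH // 𝔠.ramH ρ ⊆ S} → 𝔠.PacketH) →
        𝔠.nH ρ * 𝔠.trH ρ (𝔠.tensH S fSH fT) = 0 := by
      intro ρ hρ
      have hρ' : ¬ 𝔠.ramH ρ ⊆ S := fun h => hρ ⟨⟨ρ, h⟩, rfl⟩
      rw [((h3.2.2 S ρ fSH fT).2 hρ'), mul_zero]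
    have h := (Subtype.val_injective.hasSum_iff hoff).2 hs.hasSum
    refine h.congr_fun fun ρ => ?_
    simp only [Function.comp_apply]
    rw [(h3.2.2 S ρ.1 fSH fT).1 ρ.2, mul_assoc]
    rfl
  -- (2) fibre summability from the unit `u` (`hat g u = 1` for germs of automorphic origin)
  have Fc : ∀ t : 𝔠.AutGerm S, Summable (fun c : {c : {c : 𝔠.Cls // 𝔠.ramCls c ⊆ S} // ec c = t} =>
      (𝔠.mult c.1.1 : ℂ) * 𝔠.chS S (𝔠.coordS S c.1.1) fS) := by
    intro t
    have h := ((Hc u).summable).subtype (fun c => ec c = t)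
    refine h.congr fun c => ?_
    simp only [Function.comp_apply, hu, mul_one]
  have FQ : ∀ t : 𝔠.AutGerm S, Summable (fun Q : {Q : {Q : 𝔠.PacketG // 𝔠.ramG Q ⊆ S} // eQ Q = t} =>
      𝔠.nG Q.1.1 * 𝔠.trGS S Q.1.1 fSG) := by
    intro t
    have h := ((HQ u).summable).subtype (fun Q => eQ Q = t)
    refine h.congr fun Q => ?_
    simp only [Function.comp_apply, hu, mul_one]
  have Fρ : ∀ t : 𝔠.AutGerm S, Summable (fun ρ : {ρ : {ρ : 𝔠.PacketH // 𝔠.ramH ρ ⊆ S} // eρ ρ = t} =>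
      𝔠.nH ρ.1.1 * 𝔠.trHS S ρ.1.1 fSH) := by
    intro t
    have h := ((Hρ u).summable).subtype (fun ρ => eρ ρ = t)
    refine h.congr fun ρ => ?_
    simp only [Function.comp_apply, hu, mul_one]
  -- (3) regrouping by germs (★ B1) and the separation lemma: every germ's combination vanishes
  have hα : ∀ t : 𝔠.AutGerm S,
      (∑' c : {c : {c : 𝔠.Cls // 𝔠.ramCls c ⊆ S} // ec c = t}, (𝔠.mult c.1.1 : ℂ) * 𝔠.chS S (𝔠.coordS S c.1.1) fS) -
        ((∑' Q : {Q : {Q : 𝔠.PacketG // 𝔠.ramG Q ⊆ S} // eQ Q = t}, 𝔠.nG Q.1.1 * 𝔠.trGS S Q.1.1 fSG) +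
          (1 / 2 : ℂ) * ∑' ρ : {ρ : {ρ : 𝔠.PacketH // 𝔠.ramH ρ ⊆ S} // eρ ρ = t}, 𝔠.nH ρ.1.1 * 𝔠.trHS S ρ.1.1 fSH) = 0 := by
    have key : ∀ fT : 𝔠.Unr S, HasSum (fun t : 𝔠.AutGerm S =>
        ((∑' c : {c : {c : 𝔠.Cls // 𝔠.ramCls c ⊆ S} // ec c = t}, (𝔠.mult c.1.1 : ℂ) * 𝔠.chS S (𝔠.coordS S c.1.1) fS) -
          ((∑' Q : {Q : {Q : 𝔠.PacketG // 𝔠.ramG Q ⊆ S} // eQ Q = t}, 𝔠.nG Q.1.1 * 𝔠.trGS S Q.1.1 fSG) +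
            (1 / 2 : ℂ) * ∑' ρ : {ρ : {ρ : 𝔠.PacketH // 𝔠.ramH ρ ⊆ S} // eρ ρ = t}, 𝔠.nH ρ.1.1 * 𝔠.trHS S ρ.1.1 fSH)) *
          𝔠.hatAut S t fT) 0 := by
      intro fT
      have hc := F0P3SeparationRegroup.hasSum_regroup_by_evp ec (𝔠.hatAut S) (fun c => (𝔠.mult c.1 : ℂ))
        (fun c fS => 𝔠.chS S (𝔠.coordS S c.1) fS) fS fT (Hc fT) Fc
      have hQ := F0P3SeparationRegroup.hasSum_regroup_by_evp eQ (𝔠.hatAut S) (fun Q => 𝔠.nG Q.1)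
        (fun Q fSG => 𝔠.trGS S Q.1 fSG) fSG fT (HQ fT) FQ
      have hρ := F0P3SeparationRegroup.hasSum_regroup_by_evp eρ (𝔠.hatAut S) (fun ρ => 𝔠.nH ρ.1)
        (fun ρ fSH => 𝔠.trHS S ρ.1 fSH) fSH fT (Hρ fT) Fρ
      obtain ⟨hsm, hmt⟩ := h4 S fS fSG fSH fT hM
      obtain ⟨-, -, hid⟩ := h1 _ _ _ hsm hmt
      have htot := hc.sub (hQ.add (hρ.mul_left (1 / 2 : ℂ)))
      rw [hid, sub_self] at htot
      refine htot.congr_fun fun t => ?_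
      ring
    exact h5 S _ (fun fT => (key fT).summable) (fun fT => (key fT).tsum_eq)
  -- (4) read off at the germ `g`: either `g` is of automorphic origin, or all three fibres are empty
  by_cases hg : ∃ t, germ L H S t = g ∧
      ((∃ c, 𝔠.ramCls c ⊆ S ∧ 𝔠.evp c = t) ∨ (∃ Q, 𝔠.ramG Q ⊆ S ∧ 𝔠.evpG Q = t) ∨ (∃ ρ, 𝔠.ramH ρ ⊆ S ∧ 𝔠.evpH ρ = t))
  · -- the three fibre equivalences with the goal's index types
    let Ec : {c : {c : 𝔠.Cls // 𝔠.ramCls c ⊆ S} // ec c = ⟨g, hg⟩} ≃ {c : 𝔠.Cls // germ L H S (𝔠.evp c) = g ∧ 𝔠.ramCls c ⊆ S} :=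
      { toFun := fun c => ⟨c.1.1, congrArg Subtype.val c.2, c.1.2⟩
        invFun := fun c => ⟨⟨c.1, c.2.2⟩, Subtype.ext c.2.1⟩
        left_inv := fun c => rfl
        right_inv := fun c => rfl }
    let EQ : {Q : {Q : 𝔠.PacketG // 𝔠.ramG Q ⊆ S} // eQ Q = ⟨g, hg⟩} ≃ {Q : 𝔠.PacketG // germ L H S (𝔠.evpG Q) = g ∧ 𝔠.ramG Q ⊆ S} :=
      { toFun := fun Q => ⟨Q.1.1, congrArg Subtype.val Q.2, Q.1.2⟩
        invFun := fun Q => ⟨⟨Q.1, Q.2.2⟩, Subtype.ext Q.2.1⟩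
        left_inv := fun Q => rfl
        right_inv := fun Q => rfl }
    let Eρ : {ρ : {ρ : 𝔠.PacketH // 𝔠.ramH ρ ⊆ S} // eρ ρ = ⟨g, hg⟩} ≃ {ρ : 𝔠.PacketH // germ L H S (𝔠.evpH ρ) = g ∧ 𝔠.ramH ρ ⊆ S} :=
      { toFun := fun ρ => ⟨ρ.1.1, congrArg Subtype.val ρ.2, ρ.1.2⟩
        invFun := fun ρ => ⟨⟨ρ.1, ρ.2.2⟩, Subtype.ext ρ.2.1⟩
        left_inv := fun ρ => rfl
        right_inv := fun ρ => rfl }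
    have sc := (Ec.summable_iff (f := fun c : {c : 𝔠.Cls // germ L H S (𝔠.evp c) = g ∧ 𝔠.ramCls c ⊆ S} =>
      (𝔠.mult c.1 : ℂ) * 𝔠.chS S (𝔠.coordS S c.1) fS)).1 (Fc ⟨g, hg⟩)
    have sQ := (EQ.summable_iff (f := fun Q : {Q : 𝔠.PacketG // germ L H S (𝔠.evpG Q) = g ∧ 𝔠.ramG Q ⊆ S} =>
      𝔠.nG Q.1 * 𝔠.trGS S Q.1 fSG)).1 (FQ ⟨g, hg⟩)
    have sρ := (Eρ.summable_iff (f := fun ρ : {ρ : 𝔠.PacketH // germ L H S (𝔠.evpH ρ) = g ∧ 𝔠.ramH ρ ⊆ S} =>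
      𝔠.nH ρ.1 * 𝔠.trHS S ρ.1 fSH)).1 (Fρ ⟨g, hg⟩)
    refine ⟨sc, sQ, sρ, ?_⟩
    have h := hα ⟨g, hg⟩
    rw [← Ec.tsum_eq (fun c : {c : 𝔠.Cls // germ L H S (𝔠.evp c) = g ∧ 𝔠.ramCls c ⊆ S} =>
        (𝔠.mult c.1 : ℂ) * 𝔠.chS S (𝔠.coordS S c.1) fS),
      ← EQ.tsum_eq (fun Q : {Q : 𝔠.PacketG // germ L H S (𝔠.evpG Q) = g ∧ 𝔠.ramG Q ⊆ S} => 𝔠.nG Q.1 * 𝔠.trGS S Q.1 fSG),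
      ← Eρ.tsum_eq (fun ρ : {ρ : 𝔠.PacketH // germ L H S (𝔠.evpH ρ) = g ∧ 𝔠.ramH ρ ⊆ S} => 𝔠.nH ρ.1 * 𝔠.trHS S ρ.1 fSH)]
    exact sub_eq_zero.1 h
  · -- no class or packet has germ `g`: all three fibres are empty
    have e1 : IsEmpty {c : 𝔠.Cls // germ L H S (𝔠.evp c) = g ∧ 𝔠.ramCls c ⊆ S} :=
      ⟨fun c => hg ⟨𝔠.evp c.1, c.2.1, Or.inl ⟨c.1, c.2.2, rfl⟩⟩⟩
    have e2 : IsEmpty {Q : 𝔠.PacketG // germ L H S (𝔠.evpG Q) = g ∧ 𝔠.ramG Q ⊆ S} :=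
      ⟨fun Q => hg ⟨𝔠.evpG Q.1, Q.2.1, Or.inr (Or.inl ⟨Q.1, Q.2.2, rfl⟩)⟩⟩
    have e3 : IsEmpty {ρ : 𝔠.PacketH // germ L H S (𝔠.evpH ρ) = g ∧ 𝔠.ramH ρ ⊆ S} :=
      ⟨fun ρ => hg ⟨𝔠.evpH ρ.1, ρ.2.1, Or.inr (Or.inr ⟨ρ.1, ρ.2.2, rfl⟩)⟩⟩
    refine ⟨summable_empty, summable_empty, summable_empty, ?_⟩
    rw [tsum_empty, tsum_empty, tsum_empty]
    ring


/-- **Z10a — COEFFICIENT READING, PROVED (F0P3-p03 (g6) paste-closer 4de3ab3ebc0debe7, folded)** [Rogawski1990 p. 238 l. 11 – p. 239 l. 4]: in the germ of `t(Π(ξ))`, (14.6.2) + the A-class spectral data (L3) + the local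
expansion (L6) express `Σ_{π′} m(π′) ch_{π′_{S,∞}}` as the FINITE combination `Σ_x E_ξ(x) ch_x`; the classes are determined by their coordinates (L7′), all
coordinates in play are unitary (anchors), EVERY `f′_S` has a transfer (`TransferS`, §14.2 p. 228) so the identity holds at every `f′_S`, and linear independence of
unitary characters (L2) reads off `m(π′) = E_ξ(coords π′)`.  Size M. -/
theorem coefficientFormula_of_laws {L : Type} [Field L] [NumberField L] [IsCMField L] {H : Matrix (Fin 3) (Fin 3) L} {ι : L →+* ℂ} {T : GL (Fin 3) ℂ}
    {hT : (T : Matrix (Fin 3) (Fin 3) ℂ)ᴴ * H.map ι * (T : Matrix (Fin 3) (Fin 3) ℂ) = Literature.Geometry.ComplexHyperbolic.BallModel.J}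
    {μ : Measure (Gp L H).automorphicQuotient} [(Gp L H).IsAutomorphicMeasure μ] (𝔠 : ClassificationKit L H ι T hT μ)
    (h0 : 𝔠.PerClassIdentity) (hT : 𝔠.TransferS) (h6 : 𝔠.LinIndepS) (h6a : 𝔠.UnitaryCoord) (h6b : 𝔠.UnitaryPacket) (h7 : 𝔠.ClassDet)
    (h8 : 𝔠.APacketSpectral) (h9 : 𝔠.LocalExpansion) :
    𝔠.CoefficientFormula := by
  intro ξ S hS c₀ hc₀ hr₀
  classical
  -- the fibre `F` of the germ of `t(Π(ξ))` among classes unramified off `S`, and its (injective, by `ClassDet`) coordinate map `κ`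
  have hκ : Function.Injective
      (fun c : {c : 𝔠.Cls // germ L H S (𝔠.evp c) = germ L H S (𝔠.tXi ξ) ∧ 𝔠.ramCls c ⊆ S} => 𝔠.coordS S c.1) := by
    rintro ⟨c, hc, hcr⟩ ⟨c', hc', hc'r⟩ h
    have he : EqOff L H S (𝔠.evp c) (𝔠.evp c') := (germ_eq_germ_iff L H S _ _).1 (hc.trans hc'.symm)
    exact Subtype.ext (h7 S c c' hcr hc'r he h)
  -- the multiplicity function on coordinates (`0` off the fibre) and the expansion coefficients, both `ℂ`-valued
  obtain ⟨m, hmκ, hm0⟩ : ∃ m : 𝔠.LocS S → ℂ,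
      (∀ c : {c : 𝔠.Cls // germ L H S (𝔠.evp c) = germ L H S (𝔠.tXi ξ) ∧ 𝔠.ramCls c ⊆ S}, m (𝔠.coordS S c.1) = (𝔠.mult c.1 : ℂ)) ∧
      (∀ x : 𝔠.LocS S, (¬ ∃ c : {c : 𝔠.Cls // germ L H S (𝔠.evp c) = germ L H S (𝔠.tXi ξ) ∧ 𝔠.ramCls c ⊆ S}, 𝔠.coordS S c.1 = x) →
        m x = 0) :=
    ⟨Function.extend (fun c : {c : 𝔠.Cls // germ L H S (𝔠.evp c) = germ L H S (𝔠.tXi ξ) ∧ 𝔠.ramCls c ⊆ S} => 𝔠.coordS S c.1)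
        (fun c => (𝔠.mult c.1 : ℂ)) 0,
      fun c => hκ.extend_apply _ _ c, fun x hx => by rw [Function.extend_apply' _ _ _ hx, Pi.zero_apply]⟩
  -- the tested identity `Σ' m·ch = Σᶠ E·ch` for EVERY `fS` (transfer exists; (14.6.2) on the fibre; A-class spectral data; local expansion)
  have key : ∀ fS : 𝔠.TestS S,
      Summable (fun x => m x * 𝔠.chS S x fS) ∧
      (Function.support fun x : 𝔠.LocS S => (𝔠.expansion ξ S x : ℂ) * 𝔠.chS S x fS).Finite ∧
      ∑' x, m x * 𝔠.chS S x fS = ∑ᶠ x, (𝔠.expansion ξ S x : ℂ) * 𝔠.chS S x fS := by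
    intro fS
    obtain ⟨fSG, fSH, hM⟩ := hT S fS
    obtain ⟨hsc, -, -, hid⟩ := h0 S (germ L H S (𝔠.tXi ξ)) fS fSG fSH hM
    obtain ⟨-, -, -, -, hAP⟩ := h8 ξ S hS
    obtain ⟨hQ, hρ⟩ := hAP fSG fSH
    obtain ⟨hfin, hloc⟩ := (h9 ξ S hS).2 fS fSG fSH hM
    have hoff : ∀ x : 𝔠.LocS S,
        x ∉ Set.range (fun c : {c : 𝔠.Cls // germ L H S (𝔠.evp c) = germ L H S (𝔠.tXi ξ) ∧ 𝔠.ramCls c ⊆ S} => 𝔠.coordS S c.1) →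
        m x * 𝔠.chS S x fS = 0 := fun x hx => by
      rw [hm0 x (by simpa only [Set.mem_range] using hx), zero_mul]
    have hsupp : (Function.support fun x => m x * 𝔠.chS S x fS) ⊆
        Set.range (fun c : {c : 𝔠.Cls // germ L H S (𝔠.evp c) = germ L H S (𝔠.tXi ξ) ∧ 𝔠.ramCls c ⊆ S} => 𝔠.coordS S c.1) := by
      intro x hx
      by_contra hxr
      exact hx (hoff x hxr)
    have hcomp : ((fun x => m x * 𝔠.chS S x fS) ∘
        (fun c : {c : 𝔠.Cls // germ L H S (𝔠.evp c) = germ L H S (𝔠.tXi ξ) ∧ 𝔠.ramCls c ⊆ S} => 𝔠.coordS S c.1)) =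
        fun c => (𝔠.mult c.1 : ℂ) * 𝔠.chS S (𝔠.coordS S c.1) fS := by
      funext c
      simp only [Function.comp_apply, hmκ]
    refine ⟨(hκ.summable_iff hoff).1 (hcomp ▸ hsc), hfin, ?_⟩
    rw [← hκ.tsum_eq hsupp]
    change ∑' c, ((fun x => m x * 𝔠.chS S x fS) ∘
        (fun c : {c : 𝔠.Cls // germ L H S (𝔠.evp c) = germ L H S (𝔠.tXi ξ) ∧ 𝔠.ramCls c ⊆ S} => 𝔠.coordS S c.1)) c = _
    rw [hcomp, hid, hQ, hρ, hloc]
  -- linear independence (L2) applied to `b := m − E`, supported on unitary coordinates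
  have hb : ∀ x : 𝔠.LocS S, m x - (𝔠.expansion ξ S x : ℂ) = 0 := by
    refine h6 S (fun x => m x - (𝔠.expansion ξ S x : ℂ)) ?_ ?_ ?_
    · intro x hx
      by_cases hEx : 𝔠.expansion ξ S x = 0
      · have hmx : m x ≠ 0 := by
          intro h; apply hx; rw [h, hEx, Rat.cast_zero, sub_zero]
        obtain ⟨c, rfl⟩ : ∃ c : {c : 𝔠.Cls // germ L H S (𝔠.evp c) = germ L H S (𝔠.tXi ξ) ∧ 𝔠.ramCls c ⊆ S},
            𝔠.coordS S c.1 = x := by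
          by_contra h; exact hmx (hm0 x h)
        exact h6a S c.1
      · exact h6b ξ S x hS hEx
    · intro fS
      obtain ⟨hms, hfin, -⟩ := key fS
      simpa only [sub_mul] using hms.sub (summable_of_hasFiniteSupport hfin)
    · intro fS
      obtain ⟨hms, hfin, hid⟩ := key fS
      simp only [sub_mul]
      rw [hms.tsum_sub (summable_of_hasFiniteSupport hfin), hid, tsum_eq_finsum hfin, sub_self]
  -- read the coefficient at `c₀`
  have hc₀F : germ L H S (𝔠.evp c₀) = germ L H S (𝔠.tXi ξ) ∧ 𝔠.ramCls c₀ ⊆ S := ⟨(germ_eq_germ_iff L H S _ _).2 hc₀, hr₀⟩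
  have h := hb (𝔠.coordS S c₀)
  rw [hmκ ⟨c₀, hc₀F⟩, sub_eq_zero] at h
  exact_mod_cast h

end Summit.HodgeConjecture.HodgeConjecture.Cruxes.H413.F0P3InnerFormClassification
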